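import Literature.Probability.LatticeModels.MedialPolygonWinding

set_option linter.unusedVariables false

/-!
# Closing two oriented medial arcs inside a ball: loop erasure and greedy descent
(line `qkz-strip-boundary-arm` of crux `CardyComplexCone.EdgePrecompact`, stmt-CriticalPhenomena-11387;
second file of the planar input `medialTwoArcSurround_ball` of the residual `ufrs_slippedReturnCase_cert(J)`)

In medial coordinates (`MedialTrail.Pt`, `IsDart`): given a "centre" `(a/2, b/2)` with `a`, `b` odd
(the centre of a medial face) and the potential `pot a b p = (2 p.1 - a)² + (2 p.2 - b)²`
(four times the squared distance to the centre), every vertex is joined to a corner of the central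
face by a forward dart walk along which the potential does not increase (`gFwd`, greedy descent), and
from a corner of the central face by such a walk read backwards (`gBwd`); the boundary of the central
face is an oriented 4-cycle. Concatenating and erasing loops (`loopErase_SR`) gives, for any two
vertices `p`, `q`, a forward dart PATH (distinct vertices) from `p` to `q` all of whose vertices have
potential `≤ max (pot p) (pot q)` (`exists_dartPath_le_pot_SR`, the registered anchor). This is the
common closing path of the two arcs of `…UFRSTwoArcCore.lean` when both arcs stay outside a ball that
contains the tail of their first dart and the head of their last dart.

References: S. Smirnov, Ann. of Math. 172 (2010), §4, Fig. 5 (the oriented medial lattice).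
-/

namespace Summit.CriticalPhenomena.CardyFormulaZ2.Cruxes.EdgePrecompact.QkzStripBoundaryArm

open Literature.Probability.LatticeModels Literature.Probability.LatticeModels.MedialTrail

/-! ## Loop erasure -/

/-- A list with a repetition splits around two occurrences of the repeated element. -/
theorem exists_split_of_not_nodup_SR {α : Type*} : ∀ {W : List α}, ¬ W.Nodup →
    ∃ (A : List α) (x : α) (B C : List α), W = A ++ x :: (B ++ x :: C)
  | [], h => by simp at h
  | a :: L, h => by
    rw [List.nodup_cons, not_and_or, not_not] at h
    by_cases ha : a ∈ L
    · obtain ⟨B, C, rfl⟩ := List.append_of_mem ha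
      exact ⟨[], a, B, C, rfl⟩
    · have hL : ¬ L.Nodup := by tauto
      obtain ⟨A, x, B, C, rfl⟩ := exists_split_of_not_nodup_SR hL
      exact ⟨a :: A, x, B, C, rfl⟩

/-- **Loop erasure.** A nonempty `R`-chain contains an `R`-chain WITHOUT repeated vertices with the
same first and last vertex, through a subset of its vertices. -/
theorem loopErase_SR {α : Type*} (R : α → α → Prop) : ∀ (n : ℕ) (W : List α), W.length ≤ n → W ≠ [] →
    List.IsChain R W → ∃ W' : List α, W' ≠ [] ∧ W'.head? = W.head? ∧ W'.getLast? = W.getLast? ∧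
      List.IsChain R W' ∧ W'.Nodup ∧ ∀ p ∈ W', p ∈ W
  | 0, W, hlen, hne, _ => absurd (List.eq_nil_of_length_eq_zero (Nat.le_zero.1 hlen)) hne
  | n + 1, W, hlen, hne, hc => by
    by_cases hnd : W.Nodup
    · exact ⟨W, hne, rfl, rfl, hc, hnd, fun p hp => hp⟩
    obtain ⟨A, x, B, C, rfl⟩ := exists_split_of_not_nodup_SR hnd
    have hc' : List.IsChain R (A ++ x :: C) := by
      rw [List.isChain_split] at hc ⊢
      refine ⟨hc.1, ?_⟩
      have h2 := hc.2
      rw [show x :: (B ++ x :: C) = (x :: B) ++ x :: C from rfl, List.isChain_split] at h2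
      exact h2.2
    have hlen' : (A ++ x :: C).length ≤ n := by
      simp only [List.length_append, List.length_cons] at hlen ⊢; omega
    obtain ⟨W', h1, h2, h3, h4, h5, h6⟩ := loopErase_SR R n (A ++ x :: C) hlen' (by simp) hc'
    refine ⟨W', h1, ?_, ?_, h4, h5, fun p hp => ?_⟩
    · rw [h2]; cases A <;> rfl
    · rw [h3, show A ++ x :: (B ++ x :: C) = (A ++ x :: B) ++ x :: C by simp,
        List.getLast?_append_of_ne_nil _ (List.cons_ne_nil _ _),
        List.getLast?_append_of_ne_nil _ (List.cons_ne_nil _ _)]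
    · have := h6 p hp
      simp only [List.mem_append, List.mem_cons] at this ⊢
      tauto

/-! ## The potential and the two greedy steps -/

/-- Four times the squared distance from `p` to the point `(a/2, b/2)`. -/
def pot (a b : ℤ) (p : Pt) : ℤ := (2 * p.1 - a) ^ 2 + (2 * p.2 - b) ^ 2

/-- The sign moving the doubled coordinate `2 t` towards the odd number `a`. -/
def sgnTo (a t : ℤ) : ℤ := if 2 * t < a then 1 else -1
/-- One coordinate step towards an odd target does not increase the squared distance. -/
theorem sq_step_le_SR {a t : ℤ} (ha : a % 2 = 1) : (2 * (t + sgnTo a t) - a) ^ 2 ≤ (2 * t - a) ^ 2 := by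
  unfold sgnTo; split_ifs with h
  · have h' : 2 * t - a ≤ -1 := by omega
    nlinarith
  · have h' : 1 ≤ 2 * t - a := by omega
    nlinarith

/-- One coordinate step towards an odd target strictly decreases the squared distance unless the
doubled coordinate is already next to the target. -/
theorem sq_step_lt_SR {a t : ℤ} (ha : a % 2 = 1) (hfar : (2 * t - a) ^ 2 ≠ 1) :
    (2 * (t + sgnTo a t) - a) ^ 2 < (2 * t - a) ^ 2 := by
  have hodd : (2 * t - a) % 2 ≠ 0 := by omega
  have h1 : 2 * t - a ≠ 1 := fun h => hfar (by rw [h]; norm_num)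
  have h2 : 2 * t - a ≠ -1 := fun h => hfar (by rw [h]; norm_num)
  have h0 : 2 * t - a ≠ 0 := fun h => hodd (by rw [h]; rfl)
  unfold sgnTo; split_ifs with h
  · have : 2 * t - a ≤ -2 := by omega
    nlinarith
  · have : 2 ≤ 2 * t - a := by omega
    nlinarith

/-- The square of an odd integer is at least `1`, and equals `1` only for `±1`. -/
theorem one_le_sq_of_odd_SR {u : ℤ} (hu : u % 2 ≠ 0) : 1 ≤ u ^ 2 := by
  rcases le_or_gt 1 u with h | h
  · nlinarith
  · have : u ≤ -1 := by omega
    nlinarith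

/-- Greedy FORWARD step towards the centre: a vertical dart from an even vertex, a horizontal one
from an odd vertex, in the direction of the centre (flipping across it when adjacent). -/
def gFwd (a b : ℤ) (p : Pt) : Pt :=
  if (p.1 + p.2) % 2 = 0 then (p.1, p.2 + sgnTo b p.2) else (p.1 + sgnTo a p.1, p.2)

/-- Greedy BACKWARD step: the in-neighbour of `p` on the side of the centre (horizontal into an even
vertex, vertical into an odd one). -/
def gBwd (a b : ℤ) (p : Pt) : Pt :=
  if (p.1 + p.2) % 2 = 0 then (p.1 + sgnTo a p.1, p.2) else (p.1, p.2 + sgnTo b p.2)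

/-- The forward greedy step is a dart. -/
theorem isDart_gFwd_SR (a b : ℤ) (p : Pt) : IsDart p (gFwd a b p) := by
  unfold gFwd sgnTo IsDart; split_ifs <;> simp <;> omega

/-- The backward greedy step is a dart INTO `p`. -/
theorem isDart_gBwd_SR (a b : ℤ) (p : Pt) : IsDart (gBwd a b p) p := by
  unfold gBwd sgnTo IsDart; split_ifs <;> simp <;> omega

variable {a b : ℤ}

/-- The forward step does not increase the potential. -/
theorem pot_gFwd_le_SR (ha : a % 2 = 1) (hb : b % 2 = 1) (p : Pt) : pot a b (gFwd a b p) ≤ pot a b p := by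
  unfold gFwd pot
  split_ifs
  · have := sq_step_le_SR (t := p.2) hb; simp only; nlinarith
  · have := sq_step_le_SR (t := p.1) ha; simp only; nlinarith

/-- The backward step does not increase the potential. -/
theorem pot_gBwd_le_SR (ha : a % 2 = 1) (hb : b % 2 = 1) (p : Pt) : pot a b (gBwd a b p) ≤ pot a b p := by
  unfold gBwd pot
  split_ifs
  · have := sq_step_le_SR (t := p.1) ha; simp only; nlinarith
  · have := sq_step_le_SR (t := p.2) hb; simp only; nlinarith

/-- The potential is at least `2` (both doubled coordinates are odd distances from odd targets). -/
theorem two_le_pot_SR (ha : a % 2 = 1) (hb : b % 2 = 1) (p : Pt) : 2 ≤ pot a b p := by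
  have h1 := one_le_sq_of_odd_SR (u := 2 * p.1 - a) (by omega)
  have h2 := one_le_sq_of_odd_SR (u := 2 * p.2 - b) (by omega)
  unfold pot; omega

/-- Two greedy steps (one in each coordinate) strictly decrease the potential off the central face. -/
theorem pot_two_steps_lt_SR (ha : a % 2 = 1) (hb : b % 2 = 1) (p : Pt) (hp : pot a b p ≠ 2) :
    pot a b (p.1 + sgnTo a p.1, p.2 + sgnTo b p.2) < pot a b p := by
  have h1 := one_le_sq_of_odd_SR (u := 2 * p.1 - a) (by omega)
  have h2 := one_le_sq_of_odd_SR (u := 2 * p.2 - b) (by omega)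
  have hcase : (2 * p.1 - a) ^ 2 ≠ 1 ∨ (2 * p.2 - b) ^ 2 ≠ 1 := by
    by_contra h; push Not at h; apply hp; unfold pot; omega
  have s1 := sq_step_le_SR (t := p.2) hb
  have s2 := sq_step_le_SR (t := p.1) ha
  unfold pot; simp only
  rcases hcase with h | h
  · have := sq_step_lt_SR (t := p.1) ha h; nlinarith
  · have := sq_step_lt_SR (t := p.2) hb h; nlinarith

/-- Two forward steps strictly decrease the potential away from the central face. -/
theorem pot_gFwd_gFwd_lt_SR (ha : a % 2 = 1) (hb : b % 2 = 1) (p : Pt) (hp : pot a b p ≠ 2) :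
    pot a b (gFwd a b (gFwd a b p)) < pot a b p := by
  have key := pot_two_steps_lt_SR ha hb p hp
  by_cases hpar : (p.1 + p.2) % 2 = 0
  · have e1 : gFwd a b p = (p.1, p.2 + sgnTo b p.2) := by unfold gFwd; rw [if_pos hpar]
    have e2 : gFwd a b (p.1, p.2 + sgnTo b p.2) = (p.1 + sgnTo a p.1, p.2 + sgnTo b p.2) := by
      unfold gFwd; rw [if_neg]; simp only; unfold sgnTo; split_ifs <;> omega
    rwa [e1, e2]
  · have e1 : gFwd a b p = (p.1 + sgnTo a p.1, p.2) := by unfold gFwd; rw [if_neg hpar]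
    have e2 : gFwd a b (p.1 + sgnTo a p.1, p.2) = (p.1 + sgnTo a p.1, p.2 + sgnTo b p.2) := by
      unfold gFwd; rw [if_pos]; simp only; unfold sgnTo; split_ifs <;> omega
    rwa [e1, e2]

/-- Two backward steps strictly decrease the potential away from the central face. -/
theorem pot_gBwd_gBwd_lt_SR (ha : a % 2 = 1) (hb : b % 2 = 1) (p : Pt) (hp : pot a b p ≠ 2) :
    pot a b (gBwd a b (gBwd a b p)) < pot a b p := by
  have key := pot_two_steps_lt_SR ha hb p hp
  by_cases hpar : (p.1 + p.2) % 2 = 0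
  · have e1 : gBwd a b p = (p.1 + sgnTo a p.1, p.2) := by unfold gBwd; rw [if_pos hpar]
    have e2 : gBwd a b (p.1 + sgnTo a p.1, p.2) = (p.1 + sgnTo a p.1, p.2 + sgnTo b p.2) := by
      unfold gBwd; rw [if_neg]; simp only; unfold sgnTo; split_ifs <;> omega
    rwa [e1, e2]
  · have e1 : gBwd a b p = (p.1, p.2 + sgnTo b p.2) := by unfold gBwd; rw [if_neg hpar]
    have e2 : gBwd a b (p.1, p.2 + sgnTo b p.2) = (p.1 + sgnTo a p.1, p.2 + sgnTo b p.2) := by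
      unfold gBwd; rw [if_pos]; simp only; unfold sgnTo; split_ifs <;> omega
    rwa [e1, e2]

/-! ## Greedy walks reach the central face -/

/-- Iterating a potential-non-increasing map keeps the potential bounded by its initial value. -/
theorem pot_iterate_le_SR (f : Pt → Pt) (hf : ∀ p, pot a b (f p) ≤ pot a b p) (p : Pt) :
    ∀ k : ℕ, pot a b (f^[k] p) ≤ pot a b p
  | 0 => le_rfl
  | k + 1 => by rw [Function.iterate_succ_apply']; exact (hf _).trans (pot_iterate_le_SR f hf p k)

/-- A potential-non-increasing map that strictly decreases the potential in two steps off the central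
face reaches the central face (potential `2`). -/
theorem exists_iterate_pot_eq_two_SR (ha : a % 2 = 1) (hb : b % 2 = 1) (f : Pt → Pt)
    (hf : ∀ p, pot a b (f p) ≤ pot a b p) (hf2 : ∀ p, pot a b p ≠ 2 → pot a b (f (f p)) < pot a b p) :
    ∀ p : Pt, ∃ k : ℕ, pot a b (f^[k] p) = 2 := by
  suffices H : ∀ (n : ℕ) (p : Pt), pot a b p ≤ n → ∃ k : ℕ, pot a b (f^[k] p) = 2 by
    intro p; exact H (pot a b p).toNat p (Int.self_le_toNat _)
  intro n
  induction n with
  | zero => intro p hp; have := two_le_pot_SR ha hb p; omega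
  | succ n ih =>
    intro p hp
    by_cases h2 : pot a b p = 2
    · exact ⟨0, h2⟩
    · have := hf2 p h2
      obtain ⟨k, hk⟩ := ih (f (f p)) (by omega)
      exact ⟨k + 2, by rwa [Function.iterate_add_apply]⟩

/-- A range-indexed list is an `R`-chain as soon as consecutive values are related. -/
theorem isChain_map_range_SR {α : Type*} {R : α → α → Prop} (f : ℕ → α) (n : ℕ)
    (h : ∀ k, k + 1 < n → R (f k) (f (k + 1))) : List.IsChain R ((List.range n).map f) := by
  rw [List.isChain_iff_getElem]
  intro i hi
  simp only [List.length_map, List.length_range] at hi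
  simp only [List.getElem_map, List.getElem_range]
  exact h i hi

/-! ## The oriented boundary of the central face -/

/-- The corners of the medial face with lower-left corner `(x₀, y₀)`, listed along its ORIENTED
boundary (clockwise `N, E, S, W` from an even lower-left corner, counter-clockwise `E, N, W, S` from an
odd one), `4`-periodically. -/
def faceCyc (x₀ y₀ : ℤ) (u : ℕ) : Pt :=
  if (x₀ + y₀) % 2 = 0 then
    (if u % 4 = 0 then (x₀, y₀) else if u % 4 = 1 then (x₀, y₀ + 1) else if u % 4 = 2 then (x₀ + 1, y₀ + 1)
      else (x₀ + 1, y₀))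
  else
    (if u % 4 = 0 then (x₀, y₀) else if u % 4 = 1 then (x₀ + 1, y₀) else if u % 4 = 2 then (x₀ + 1, y₀ + 1)
      else (x₀, y₀ + 1))

/-- Consecutive corners along the oriented boundary of a face form a dart. -/
theorem isDart_faceCyc_SR (x₀ y₀ : ℤ) (u : ℕ) : IsDart (faceCyc x₀ y₀ u) (faceCyc x₀ y₀ (u + 1)) := by
  obtain ⟨r, hr, hu, hu'⟩ : ∃ r < 4, u % 4 = r ∧ (u + 1) % 4 = (r + 1) % 4 := ⟨u % 4, Nat.mod_lt _ (by norm_num), rfl, by omega⟩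
  unfold faceCyc
  rw [hu, hu']
  interval_cases r <;> by_cases hpar : (x₀ + y₀) % 2 = 0 <;> simp [hpar, IsDart] <;> omega

/-- `faceCyc` only depends on the index modulo `4`. -/
theorem faceCyc_congr_SR (x₀ y₀ : ℤ) {u u' : ℕ} (h : u % 4 = u' % 4) : faceCyc x₀ y₀ u = faceCyc x₀ y₀ u' := by
  unfold faceCyc; rw [h]

/-- Every corner of the face occurs along its oriented boundary. -/
theorem exists_faceCyc_eq_SR (x₀ y₀ : ℤ) (p : Pt) (h1 : p.1 = x₀ ∨ p.1 = x₀ + 1) (h2 : p.2 = y₀ ∨ p.2 = y₀ + 1) :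
    ∃ u < 4, faceCyc x₀ y₀ u = p := by
  obtain ⟨x, y⟩ := p
  simp only at h1 h2
  unfold faceCyc
  by_cases hpar : (x₀ + y₀) % 2 = 0 <;> simp only [hpar, if_true, if_false]
  · rcases h1 with rfl | rfl <;> rcases h2 with rfl | rfl
    exacts [⟨0, by norm_num, by simp⟩, ⟨1, by norm_num, by simp⟩, ⟨3, by norm_num, by simp⟩, ⟨2, by norm_num, by simp⟩]
  · rcases h1 with rfl | rfl <;> rcases h2 with rfl | rfl
    exacts [⟨0, by norm_num, by simp⟩, ⟨3, by norm_num, by simp⟩, ⟨1, by norm_num, by simp⟩, ⟨2, by norm_num, by simp⟩]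

/-- The corners of the central face are the points of potential `2`, and conversely every corner
along the boundary has potential `2`. -/
theorem pot_faceCyc_SR (ha : a % 2 = 1) (hb : b % 2 = 1) (u : ℕ) :
    pot a b (faceCyc ((a - 1) / 2) ((b - 1) / 2) u) = 2 := by
  have ea : 2 * ((a - 1) / 2) = a - 1 := by omega
  have eb : 2 * ((b - 1) / 2) = b - 1 := by omega
  unfold faceCyc pot
  split_ifs <;> simp only <;> nlinarith [ea, eb]

/-- A point of potential `2` is a corner of the central face. -/
theorem corner_of_pot_eq_two_SR (ha : a % 2 = 1) (hb : b % 2 = 1) {p : Pt} (hp : pot a b p = 2) :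
    (p.1 = (a - 1) / 2 ∨ p.1 = (a - 1) / 2 + 1) ∧ (p.2 = (b - 1) / 2 ∨ p.2 = (b - 1) / 2 + 1) := by
  have h1 := one_le_sq_of_odd_SR (u := 2 * p.1 - a) (by omega)
  have h2 := one_le_sq_of_odd_SR (u := 2 * p.2 - b) (by omega)
  unfold pot at hp
  have e1 : (2 * p.1 - a) ^ 2 = 1 := by omega
  have e2 : (2 * p.2 - b) ^ 2 = 1 := by omega
  have f1 : (2 * p.1 - a - 1) * (2 * p.1 - a + 1) = 0 := by nlinarith
  have f2 : (2 * p.2 - b - 1) * (2 * p.2 - b + 1) = 0 := by nlinarith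
  rcases mul_eq_zero.1 f1 with h | h <;> rcases mul_eq_zero.1 f2 with h' | h' <;> constructor <;> omega

/-! ## A dart path between two vertices, not leaving the larger of their potentials -/

/-- **Closing path** (registered anchor of this file). For a centre `(a/2, b/2)` with `a`, `b` odd
and any two medial vertices `p`, `q`, there is a forward dart path `K 0 = p, K 1, …, K M = q` of the
oriented medial graph with pairwise distinct vertices, all of potential at most `max (pot p) (pot q)`
(four times the squared distance to the centre): inside any disc about the centre containing `p` and
`q`. -/
theorem exists_dartPath_le_pot_SR : ∀ (a b : ℤ) (p q : MedialTrail.Pt), a % 2 = 1 → b % 2 = 1 → ∃ (K : ℕ → MedialTrail.Pt) (M : ℕ), K 0 = p ∧ K M = q ∧ (∀ u < M, MedialTrail.IsDart (K u) (K (u + 1))) ∧ (∀ u ≤ M, ∀ u' ≤ M, K u = K u' → u = u') ∧ (∀ u ≤ M, (2 * (K u).1 - a) ^ 2 + (2 * (K u).2 - b) ^ 2 ≤ max ((2 * p.1 - a) ^ 2 + (2 * p.2 - b) ^ 2) ((2 * q.1 - a) ^ 2 + (2 * q.2 - b) ^ 2)) := by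
  intro a b p q ha hb
  -- the relation: dart or stay
  set R : Pt → Pt → Prop := fun u v => IsDart u v ∨ u = v with hR
  -- incoming greedy walk from `p` to a corner `α` of the central face
  obtain ⟨k₁, hk₁⟩ := exists_iterate_pot_eq_two_SR ha hb (gFwd a b) (pot_gFwd_le_SR ha hb)
    (pot_gFwd_gFwd_lt_SR ha hb) p
  obtain ⟨k₂, hk₂⟩ := exists_iterate_pot_eq_two_SR ha hb (gBwd a b) (pot_gBwd_le_SR ha hb)
    (pot_gBwd_gBwd_lt_SR ha hb) q
  set α := (gFwd a b)^[k₁] p with hα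
  set β := (gBwd a b)^[k₂] q with hβ
  set x₀ := (a - 1) / 2 with hx₀
  set y₀ := (b - 1) / 2 with hy₀
  obtain ⟨i, hi, hiα⟩ := exists_faceCyc_eq_SR x₀ y₀ α (corner_of_pot_eq_two_SR ha hb hk₁).1
    (corner_of_pot_eq_two_SR ha hb hk₁).2
  obtain ⟨j, hj, hjβ⟩ := exists_faceCyc_eq_SR x₀ y₀ β (corner_of_pot_eq_two_SR ha hb hk₂).1
    (corner_of_pot_eq_two_SR ha hb hk₂).2
  -- the three pieces
  set Win : List Pt := (List.range (k₁ + 1)).map fun k => (gFwd a b)^[k] p with hWin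
  set m := (j + 4 - i) % 4 with hm
  set Mid : List Pt := (List.range (m + 1)).map fun u => faceCyc x₀ y₀ (i + u) with hMid
  set Wout : List Pt := ((List.range (k₂ + 1)).map fun k => (gBwd a b)^[k] q).reverse with hWout
  have cWin : List.IsChain R Win :=
    isChain_map_range_SR _ _ fun k _ => Or.inl (by rw [Function.iterate_succ_apply']; exact isDart_gFwd_SR a b _)
  have cMid : List.IsChain R Mid :=
    isChain_map_range_SR _ _ fun u _ => Or.inl (by rw [← add_assoc]; exact isDart_faceCyc_SR x₀ y₀ _)
  have cWout : List.IsChain R Wout := by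
    rw [hWout, List.isChain_reverse]
    exact isChain_map_range_SR _ _ fun k _ => Or.inl (by rw [Function.iterate_succ_apply']; exact isDart_gBwd_SR a b _)
  -- junction values (the two list facts are kept local: they exist elsewhere in the tree)
  have getLast?_map_range_succ_SR : ∀ (f : ℕ → Pt) (n : ℕ), ((List.range (n + 1)).map f).getLast? = some (f n) :=
    fun f n => by rw [List.range_succ, List.map_append, List.map_singleton, List.getLast?_append]; rfl
  have head?_map_range_succ_SR : ∀ (f : ℕ → Pt) (n : ℕ), ((List.range (n + 1)).map f).head? = some (f 0) :=
    fun f n => by rw [List.range_succ_eq_map]; rfl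
  have eWin_last : Win.getLast? = some α := getLast?_map_range_succ_SR _ _
  have eWin_head : Win.head? = some p := head?_map_range_succ_SR _ _
  have eMid_head : Mid.head? = some α := by
    rw [hMid, head?_map_range_succ_SR, add_zero, hiα]
  have eMid_last : Mid.getLast? = some β := by
    rw [hMid, getLast?_map_range_succ_SR, ← hjβ, faceCyc_congr_SR x₀ y₀ (u' := j) (by omega)]
  have eWout_head : Wout.head? = some β := by
    rw [hWout, List.head?_reverse, getLast?_map_range_succ_SR]
  have eWout_last : Wout.getLast? = some q := by
    rw [hWout, List.getLast?_reverse, head?_map_range_succ_SR]; rfl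
  have hMidne : Mid ≠ [] := by rw [hMid]; simp
  have hWoutne : Wout ≠ [] := by rw [hWout]; simp
  -- the glued walk
  set W := Win ++ (Mid ++ Wout) with hW
  have cW : List.IsChain R W := by
    refine List.IsChain.append cWin (List.IsChain.append cMid cWout ?_) ?_
    · intro x hx y hy
      rw [eMid_last] at hx; rw [eWout_head] at hy
      simp only [Option.mem_def, Option.some.injEq] at hx hy
      rw [← hx, ← hy]; exact Or.inr rfl
    · intro x hx y hy
      rw [eWin_last] at hx; rw [List.head?_append, eMid_head, Option.some_or] at hy
      simp only [Option.mem_def, Option.some.injEq] at hx hy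
      rw [← hx, ← hy]; exact Or.inr rfl
  have hWne : W ≠ [] := by rw [hW, hWin]; simp
  have eW_head : W.head? = some p := by rw [hW, List.head?_append, eWin_head, Option.some_or]
  have eW_last : W.getLast? = some q := by
    rw [hW, ← List.append_assoc, List.getLast?_append_of_ne_nil _ hWoutne, eWout_last]
  have potW : ∀ x ∈ W, pot a b x ≤ max (pot a b p) (pot a b q) := by
    intro x hx
    rw [hW, List.mem_append, List.mem_append] at hx
    rcases hx with hx | hx | hx
    · rw [hWin, List.mem_map] at hx
      obtain ⟨k, -, rfl⟩ := hx
      exact (pot_iterate_le_SR _ (pot_gFwd_le_SR ha hb) p k).trans (le_max_left _ _)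
    · rw [hMid, List.mem_map] at hx
      obtain ⟨u, -, rfl⟩ := hx
      rw [pot_faceCyc_SR ha hb]
      exact (two_le_pot_SR ha hb p).trans (le_max_left _ _)
    · rw [hWout, List.mem_reverse, List.mem_map] at hx
      obtain ⟨k, -, rfl⟩ := hx
      exact (pot_iterate_le_SR _ (pot_gBwd_le_SR ha hb) q k).trans (le_max_right _ _)
  -- erase loops
  obtain ⟨W', hW'ne, hW'head, hW'last, cW', hW'nd, hW'sub⟩ := loopErase_SR R W.length W le_rfl hWne cW
  rw [eW_head] at hW'head; rw [eW_last] at hW'last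
  have hlen : 0 < W'.length := List.length_pos_of_ne_nil hW'ne
  refine ⟨fun u => W'.getD u q, W'.length - 1, ?_, ?_, ?_, ?_, ?_⟩
  · show W'.getD 0 q = p
    rw [List.getD_eq_getElem _ _ hlen]
    rw [List.head?_eq_getElem?, List.getElem?_eq_getElem hlen, Option.some.injEq] at hW'head
    exact hW'head
  · show W'.getD (W'.length - 1) q = q
    rw [List.getD_eq_getElem _ _ (by omega)]
    rw [List.getLast?_eq_getElem?, List.getElem?_eq_getElem (by omega), Option.some.injEq] at hW'last
    exact hW'last
  · intro u hu
    simp only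
    rw [List.getD_eq_getElem _ _ (by omega), List.getD_eq_getElem _ _ (by omega)]
    have hr := (List.isChain_iff_getElem.1 cW') u (by omega)
    rcases hr with hr | hr
    · exact hr
    · exact absurd ((hW'nd.getElem_inj_iff).1 hr) (by omega)
  · intro u hu u' hu' huu
    simp only at huu
    rw [List.getD_eq_getElem _ _ (by omega), List.getD_eq_getElem _ _ (by omega)] at huu
    exact (hW'nd.getElem_inj_iff).1 huu
  · intro u hu
    show pot a b (W'.getD u q) ≤ max (pot a b p) (pot a b q)
    rw [List.getD_eq_getElem _ _ (by omega)]
    exact potW _ (hW'sub _ (List.getElem_mem _))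

end Summit.CriticalPhenomena.CardyFormulaZ2.Cruxes.EdgePrecompact.QkzStripBoundaryArm
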